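/-
Copyright: rh-split cell (screw, bridge) gen 17, 2026-08-27.  Splitting search over kernel-typed
RH-equivalences.  A splitting `A ∧ B ⟹ RH` is CONDITIONAL bookkeeping unless `A` and `B` are both
proved; nothing here bears on the truth of RH.
-/
import Summits.RiemannHypothesis.RiemannHypothesis.Theorems.Splittings.ScrewLatticeContinuationA
import Summits.RiemannHypothesis.RiemannHypothesis.Theorems.Splittings.ScrewBlaschkeTopA
import HarnessLib

/-!
(CARVE A of `ScrewBlaschkeSeam`: §§1–2 — the polar/regular algebra and the ζ-side objects; the theorem is in carve B.)
# The KERNEL SEAM of row X-BL: `T-BL(h)` — `CEIL(h) ∧ TBL ⟹ RH` (`blaschkeTransparency`)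

Fix a step `h > 0`.  `CEIL(h)` (`ScrewLatticeContinuation.LatticeCeiling h`: the lattice samples
`Ψ(k h)` of Suzuki's screw function grow sub-exponentially) and `TBL` (`ScrewBlaschkeTop.TopBlaschke`:
SOME top band `Θ - δ < Re ρ < Θ` below the supremal abscissa `Θ = sup Re ρ` has summable depths
`∑ (Θ - Re ρ) < ∞`) together imply the Riemann hypothesis.  This file PROVES the statement that
`ScrewBlaschkeTop` recorded as the `@[conjecture]` seam `BlaschkeTransparency h`; with it the row
`latticeCeiling_and_topBlaschke_iff_rh_of` becomes unconditional:
`(CEIL(h) ∧ TBL) ↔ RH` (`latticeCeiling_and_topBlaschke_iff_rh`), and dually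
`CEIL(h) ∧ ¬RH ⟹ ∀ δ > 0, ¬BL(δ)` (`nonBlaschkeResidue`): under one-step sub-exponential lattice growth
the zeros off the critical line, if any, crowd below their NON-attained supremal abscissa with DIVERGENT
total depth in every top band.

Proof.  Assume `CEIL(h)`, `BL(δ₀)`, `¬RH`.  By `ScrewBlaschkeTop.latticeCeiling_dichotomy_top`, `Θ > 1/2`
is not attained.  Put `r* = e^{-(Θ-1/2)h}`, `δ = min δ₀ (Θ - 1/2)`, `R₁ = r* e^{δ h} ≤ 1`, and split the
zeros into TOP (`|Re ρ - 1/2| > Θ - 1/2 - δ`: in-disc pole `p_ρ ∈ {u_ρ, u_ρ⁻¹}` of modulus in `(r*, R₁)`)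
and REST.  Each Borel term splits as `term c u z = polar c p z + regular c p z` with
`polar = (c/2)(1 - z/p)⁻¹`.  The function `H = P_h - ∑_REST term - ∑_TOP regular` is holomorphic on
`‖z‖ < R₁` (`CEIL(h)` gives `P_h = latticeGF h` holomorphic on the disc, `ScrewLatticeContinuation.
differentiableOn_latticeGF`; the two series by M-tests) and equals `P = ∑_TOP polar` near `0`
(`latticeGF_eq_borel`), hence on `‖z‖ < r*` (identity theorem).  Invert, `w = r*/z`:
`polar c p (r*/w) = c/2 + (c w_p/2)/(w - w_p)`, `w_p = r*/p ∈ 𝔻`, so on `‖w‖ > 1` the ℓ¹ Borel series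
`∑_TOP b_ρ/(w - w_ρ)` (`b_ρ = c_ρ w_ρ/2`) equals `g(w) - c₀` with `g(w) = H(r*/w)` holomorphic on
`‖w‖ > e^{-δ h}`, and its poles are BLASCHKE: `1 - ‖w_ρ‖ ≤ h·(depth of ρ or of 1 - ρ̄) `, summable by
`BL(δ)`.  The ζ-free rigidity theorem `ScrewBlaschkeRigidity.cluster_charge_eq_zero` then says that the
total charge `∑_{ρ ↦ p} b_ρ = (w_p/2) ∑_{ρ ↦ p} c_ρ` of every pole fibre vanishes — impossible, since
`Re c_ρ < 0` (`re_coeff_neg`) and TOP is non-empty.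

No `sorry`, no new axioms, no instances, no notation.
-/

set_option linter.dupNamespace false

namespace Summit.RiemannHypothesis.RiemannHypothesis.Theorems.Splittings.ScrewBlaschkeSeam

open Complex Filter Topology Set Metric
open scoped ComplexConjugate
open Literature.NumberTheory.LFunctions
open ZetaZeros.riemannZetaNontrivialZeros
open Summit.RiemannHypothesis.RiemannHypothesis.Theorems.Splittings
open Summit.RiemannHypothesis.RiemannHypothesis.Theorems.Splittings.ScrewBorel
open Summit.RiemannHypothesis.RiemannHypothesis.Theorems.Splittings.ScrewLatticeContinuation
open Summit.RiemannHypothesis.RiemannHypothesis.Theorems.Splittings.ScrewBlaschkeTop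

/-! ## 1. Polar / regular splitting of a Borel term at a representative `p ∈ {u, u⁻¹}` (ζ-free) -/

/-- The polar part `(c/2)(1 - z/p)⁻¹` of a Borel term at the representative `p`. -/
noncomputable def polar (c p z : ℂ) : ℂ := c / 2 * (1 - z / p)⁻¹

/-- The regular part `c((1/2)(1 - p z)⁻¹ - (1 - z)⁻¹)` of a Borel term at the representative `p`. -/
noncomputable def regular (c p z : ℂ) : ℂ := c * (1 / 2 * (1 - p * z)⁻¹ - (1 - z)⁻¹)

/-- `term c u z = polar c p z + regular c p z` for `p = u` or `p = u⁻¹` (the term is symmetric in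
`u ↔ u⁻¹`). -/
theorem term_eq_polar_add_regular {c u p : ℂ} (hp : p = u ∨ p = u⁻¹) (z : ℂ) :
    term c u z = polar c p z + regular c p z := by
  unfold term polar regular
  rcases hp with rfl | rfl
  · ring
  · have e1 : u * z = z / u⁻¹ := by rw [div_inv_eq_mul, mul_comm]
    have e2 : z / u = u⁻¹ * z := by rw [div_eq_mul_inv, mul_comm]
    rw [e1, e2]
    ring

/-- `‖z‖ ≤ R' < r ≤ ‖p‖`, `0 < r` ⇒ `‖polar c p z‖ ≤ ‖c‖ / (1 - R'/r)`. -/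
theorem norm_polar_le {c p z : ℂ} {R' r : ℝ} (hr : 0 < r) (hR' : R' < r) (hz : ‖z‖ ≤ R')
    (hp : r ≤ ‖p‖) : ‖polar c p z‖ ≤ ‖c‖ / (1 - R' / r) := by
  have hp0 : 0 < ‖p‖ := hr.trans_le hp
  have hR'0 : 0 ≤ R' := (norm_nonneg z).trans hz
  have h1 : ‖z / p‖ ≤ R' / r := by
    rw [norm_div]
    calc ‖z‖ / ‖p‖ ≤ R' / ‖p‖ := by gcongr
      _ ≤ R' / r := by gcongr
  have hgap : 0 < 1 - R' / r := by
    rw [sub_pos, div_lt_one hr]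
    exact hR'
  have h3 : ‖(1 - z / p)⁻¹‖ ≤ (1 - R' / r)⁻¹ := norm_inv_le_of_le hgap (one_sub_le_norm_one_sub h1)
  have hc2 : ‖c / 2‖ ≤ ‖c‖ := by
    rw [norm_div]
    have : ‖(2 : ℂ)‖ = 2 := by simp
    rw [this]
    linarith [norm_nonneg c]
  unfold polar
  rw [norm_mul]
  calc ‖c / 2‖ * ‖(1 - z / p)⁻¹‖ ≤ ‖c‖ * (1 - R' / r)⁻¹ := by gcongr
    _ = ‖c‖ / (1 - R' / r) := (div_eq_mul_inv _ _).symm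

/-- `‖z‖ ≤ R' < 1`, `‖p‖ ≤ 1` ⇒ `‖regular c p z‖ ≤ 2‖c‖/(1 - R')`. -/
theorem norm_regular_le {c p z : ℂ} {R' : ℝ} (hR' : R' < 1) (hz : ‖z‖ ≤ R') (hp : ‖p‖ ≤ 1) :
    ‖regular c p z‖ ≤ 2 * ‖c‖ / (1 - R') := by
  have hgap : 0 < 1 - R' := by linarith
  have h1 : ‖p * z‖ ≤ R' := by
    rw [norm_mul]
    calc ‖p‖ * ‖z‖ ≤ 1 * R' := by gcongr
      _ = R' := one_mul _
  have e1 := norm_inv_le_of_le hgap (one_sub_le_norm_one_sub h1)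
  have e2 := norm_inv_le_of_le hgap (one_sub_le_norm_one_sub hz)
  have hin : ‖(1 / 2 : ℂ) * (1 - p * z)⁻¹ - (1 - z)⁻¹‖ ≤ 2 / (1 - R') := by
    calc ‖(1 / 2 : ℂ) * (1 - p * z)⁻¹ - (1 - z)⁻¹‖
        ≤ ‖(1 / 2 : ℂ) * (1 - p * z)⁻¹‖ + ‖(1 - z)⁻¹‖ := norm_sub_le _ _
      _ ≤ 1 / 2 * (1 - R')⁻¹ + (1 - R')⁻¹ := by
          gcongr
          rw [norm_mul]
          have : ‖(1 / 2 : ℂ)‖ = 1 / 2 := by simp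
          rw [this]
          gcongr
      _ ≤ 2 / (1 - R') := by
          rw [div_eq_mul_inv (2 : ℝ) (1 - R')]
          nlinarith [inv_pos.2 hgap]
  unfold regular
  rw [norm_mul]
  calc ‖c‖ * ‖(1 / 2 : ℂ) * (1 - p * z)⁻¹ - (1 - z)⁻¹‖ ≤ ‖c‖ * (2 / (1 - R')) := by gcongr
    _ = 2 * ‖c‖ / (1 - R') := by ring

/-- Differentiability of the polar part where its denominator does not vanish. -/
theorem differentiableAt_polar {c p z : ℂ} (h : 1 - z / p ≠ 0) :
    DifferentiableAt ℂ (fun w ↦ polar c p w) z := by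
  unfold polar
  exact (differentiableAt_const _).mul
    (((differentiableAt_const _).sub (differentiableAt_id.div_const p)).inv h)

/-- Differentiability of the regular part where its denominators do not vanish. -/
theorem differentiableAt_regular {c p z : ℂ} (h1 : 1 - p * z ≠ 0) (h2 : 1 - z ≠ 0) :
    DifferentiableAt ℂ (fun w ↦ regular c p w) z := by
  unfold regular
  have d1 : DifferentiableAt ℂ (fun w : ℂ ↦ (1 - p * w)⁻¹) z :=
    ((differentiableAt_const _).sub ((differentiableAt_const _).mul differentiableAt_id)).inv h1
  have d2 : DifferentiableAt ℂ (fun w : ℂ ↦ (1 - w)⁻¹) z :=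
    ((differentiableAt_const _).sub differentiableAt_id).inv h2
  exact (differentiableAt_const c).mul (((differentiableAt_const _).mul d1).sub d2)

/-- INVERSION `z = r/w`: `polar c p (r/w) = c/2 + (c·(r/p)/2)/(w - r/p)` (`p, w ≠ 0`, `w ≠ r/p`). -/
theorem polar_inv_eq {c p r w : ℂ} (hp : p ≠ 0) (hw : w ≠ 0) (hwp : w ≠ r / p) :
    polar c p (r / w) = c / 2 + c * (r / p) / 2 / (w - r / p) := by
  have h1 : w - r / p ≠ 0 := sub_ne_zero.2 hwp
  have h2 : w * p - r ≠ 0 := by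
    intro h0
    apply hwp
    rw [eq_div_iff hp]
    linear_combination h0
  unfold polar
  have e : 1 - r / w / p = (w - r / p) / w := by
    rw [sub_div, div_self hw, div_div, div_div, mul_comm w p]
  rw [e, inv_div]
  field_simp
  ring

/-- Differentiability on a ball from differentiability on every strictly smaller concentric ball. -/
theorem differentiableOn_ball_of_forall_lt {f : ℂ → ℂ} {R : ℝ}
    (h : ∀ R' : ℝ, R' < R → DifferentiableOn ℂ f (ball 0 R')) : DifferentiableOn ℂ f (ball 0 R) := by
  intro z hz
  rw [mem_ball_zero_iff] at hz
  have h1 : DifferentiableOn ℂ f (ball 0 ((‖z‖ + R) / 2)) := h _ (by linarith)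
  have hz' : z ∈ ball (0 : ℂ) ((‖z‖ + R) / 2) := by
    rw [mem_ball_zero_iff]
    linarith
  exact (h1.differentiableAt (isOpen_ball.mem_nhds hz')).differentiableWithinAt

/-! ## 2. The ζ-side objects: in-disc representatives, the top layer, the inverted poles -/

/-- The in-disc representative `p_ρ ∈ {u_ρ, u_ρ⁻¹}` of the zero `ρ`: `u_ρ⁻¹` if `Re ρ > 1/2`, else `u_ρ`;
`‖p_ρ‖ = e^{-|Re ρ - 1/2| h}`. -/
noncomputable def pole (h : ℝ) (ρ : ZetaZeros.riemannZetaNontrivialZeros) : ℂ :=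
  if 1 / 2 < (ρ : ℂ).re then (mult h ρ)⁻¹ else mult h ρ

/-- `r* = e^{-(Θ - 1/2) h}`: the radius of the pole-free core. -/
noncomputable def rstar (h : ℝ) : ℝ := Real.exp (-((supRe - 1 / 2) * h))

/-- `R₁ = r* e^{δ h} = e^{-(Θ - 1/2 - δ) h}`: the outer radius of the top annulus. -/
noncomputable def outerR (h δ : ℝ) : ℝ := Real.exp (-((supRe - 1 / 2 - δ) * h))

/-- TOP(δ): the zeros of offset `|Re ρ - 1/2| > Θ - 1/2 - δ` (the zero or its mirror image `1 - ρ̄`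
lies in the top band of width `δ`). -/
def topSet (δ : ℝ) : Set ZetaZeros.riemannZetaNontrivialZeros :=
  {ρ | supRe - 1 / 2 - δ < |(ρ : ℂ).re - 1 / 2|}

/-- The inverted pole `w_ρ = r*/p_ρ`. -/
noncomputable def wp (h : ℝ) (ρ : ZetaZeros.riemannZetaNontrivialZeros) : ℂ := (rstar h : ℂ) / pole h ρ

/-- The mirror zero `1 - ρ̄`. -/
noncomputable def mirror (ρ : ZetaZeros.riemannZetaNontrivialZeros) :
    ZetaZeros.riemannZetaNontrivialZeros :=
  ⟨1 - conj (ρ : ℂ), one_sub_conj_mem ρ.2⟩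

/-- `Re (1 - ρ̄) = 1 - Re ρ`. -/
theorem mirror_re (ρ : ZetaZeros.riemannZetaNontrivialZeros) :
    ((mirror ρ : ZetaZeros.riemannZetaNontrivialZeros) : ℂ).re = 1 - (ρ : ℂ).re := by
  simp [mirror]

/-- `ρ ↦ 1 - ρ̄` is injective. -/
theorem mirror_injective : Function.Injective mirror := by
  intro a b hab
  apply Subtype.ext
  have h1 := congrArg (fun ρ : ZetaZeros.riemannZetaNontrivialZeros ↦ conj (1 - (ρ : ℂ))) hab
  simpa [mirror] using h1

/-- `p_ρ = u_ρ` or `p_ρ = u_ρ⁻¹`. -/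
theorem pole_eq_or (h : ℝ) (ρ : ZetaZeros.riemannZetaNontrivialZeros) :
    pole h ρ = mult h ρ ∨ pole h ρ = (mult h ρ)⁻¹ := by
  unfold pole
  split_ifs
  · exact Or.inr rfl
  · exact Or.inl rfl

/-- `p_ρ ≠ 0`. -/
theorem pole_ne_zero (h : ℝ) (ρ : ZetaZeros.riemannZetaNontrivialZeros) : pole h ρ ≠ 0 := by
  rcases pole_eq_or h ρ with e | e <;> rw [e]
  · exact mult_ne_zero h ρ
  · exact inv_ne_zero (mult_ne_zero h ρ)

/-- `‖p_ρ‖ = e^{-|Re ρ - 1/2| h}`. -/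
theorem norm_pole (h : ℝ) (ρ : ZetaZeros.riemannZetaNontrivialZeros) :
    ‖pole h ρ‖ = Real.exp (-(|(ρ : ℂ).re - 1 / 2| * h)) := by
  unfold pole
  split_ifs with hβ
  · rw [norm_inv, norm_mult, ← Real.exp_neg, abs_of_pos (by linarith)]
  · push Not at hβ
    rw [norm_mult, abs_of_nonpos (by linarith), neg_mul, neg_neg]

/-- `‖p_ρ‖ ≤ 1` for `h ≥ 0`. -/
theorem norm_pole_le_one {h : ℝ} (hh : 0 ≤ h) (ρ : ZetaZeros.riemannZetaNontrivialZeros) :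
    ‖pole h ρ‖ ≤ 1 := by
  rw [norm_pole, Real.exp_le_one_iff, neg_nonpos]
  exact mul_nonneg (abs_nonneg _) hh

/-- If `‖u_ρ⁻¹‖ < 1` then the representative is `u_ρ⁻¹` (`h > 0`). -/
theorem pole_eq_inv_of_norm_inv_lt {h : ℝ} (hh : 0 < h) {ρ : ZetaZeros.riemannZetaNontrivialZeros}
    (hu : ‖(mult h ρ)⁻¹‖ < 1) : pole h ρ = (mult h ρ)⁻¹ := by
  have hpos : 0 < ‖mult h ρ‖ := norm_pos_iff.2 (mult_ne_zero h ρ)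
  rw [norm_inv] at hu
  have h1 : 1 < ‖mult h ρ‖ := by
    rcases (inv_lt_one_iff₀).1 hu with h0 | h0
    · exact absurd h0 (not_le.2 hpos)
    · exact h0
  rw [norm_mult, Real.one_lt_exp_iff] at h1
  have hβ : 1 / 2 < (ρ : ℂ).re := by
    by_contra hle
    push Not at hle
    nlinarith
  unfold pole
  rw [if_pos hβ]

/-- If `‖u_ρ‖ < 1` then the representative is `u_ρ` (`h > 0`). -/
theorem pole_eq_of_norm_lt {h : ℝ} (hh : 0 < h) {ρ : ZetaZeros.riemannZetaNontrivialZeros}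
    (hu : ‖mult h ρ‖ < 1) : pole h ρ = mult h ρ := by
  rw [norm_mult, Real.exp_lt_one_iff] at hu
  have hβ : ¬ 1 / 2 < (ρ : ℂ).re := by
    intro hlt
    nlinarith
  unfold pole
  rw [if_neg hβ]

/-- Under non-attainment every offset is `< Θ - 1/2`. -/
theorem abs_lt_of_forall_re_lt
    (hlt : ∀ ρ : ℂ, ρ ∈ ZetaZeros.riemannZetaNontrivialZeros → ρ.re < supRe)
    (ρ : ZetaZeros.riemannZetaNontrivialZeros) : |(ρ : ℂ).re - 1 / 2| < supRe - 1 / 2 := by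
  rw [abs_lt]
  have h1 := hlt _ ρ.2
  have h2 := hlt _ (one_sub_conj_mem ρ.2)
  simp only [Complex.sub_re, Complex.one_re, Complex.conj_re] at h2
  constructor <;> linarith

/-- `r* < ‖p_ρ‖` under non-attainment (`h > 0`): the core `‖z‖ < r*` is pole-free. -/
theorem rstar_lt_norm_pole {h : ℝ} (hh : 0 < h)
    (hlt : ∀ ρ : ℂ, ρ ∈ ZetaZeros.riemannZetaNontrivialZeros → ρ.re < supRe)
    (ρ : ZetaZeros.riemannZetaNontrivialZeros) : rstar h < ‖pole h ρ‖ := by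
  rw [norm_pole, rstar, Real.exp_lt_exp, neg_lt_neg_iff]
  exact mul_lt_mul_of_pos_right (abs_lt_of_forall_re_lt hlt ρ) hh

/-- `R₁ ≤ ‖p_ρ‖` for the zeros NOT in the top layer (`h ≥ 0`). -/
theorem outerR_le_norm_pole {h δ : ℝ} (hh : 0 ≤ h) {ρ : ZetaZeros.riemannZetaNontrivialZeros}
    (hρ : ρ ∉ topSet δ) : outerR h δ ≤ ‖pole h ρ‖ := by
  have hle : |(ρ : ℂ).re - 1 / 2| ≤ supRe - 1 / 2 - δ := not_lt.1 hρ
  rw [norm_pole, outerR, Real.exp_le_exp, neg_le_neg_iff]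
  exact mul_le_mul_of_nonneg_right hle hh

/-- `R₁ ≤ 1` when `δ ≤ Θ - 1/2` and `h ≥ 0`. -/
theorem outerR_le_one {h δ : ℝ} (hh : 0 ≤ h) (hδ : δ ≤ supRe - 1 / 2) : outerR h δ ≤ 1 := by
  rw [outerR, Real.exp_le_one_iff, neg_nonpos]
  exact mul_nonneg (by linarith) hh

/-- `r* ≤ R₁` when `0 ≤ δ` and `h ≥ 0`. -/
theorem rstar_le_outerR {h δ : ℝ} (hh : 0 ≤ h) (hδ : 0 ≤ δ) : rstar h ≤ outerR h δ := by
  rw [rstar, outerR, Real.exp_le_exp, neg_le_neg_iff]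
  exact mul_le_mul_of_nonneg_right (by linarith) hh

/-- `0 < r*`. -/
theorem rstar_pos (h : ℝ) : 0 < rstar h := Real.exp_pos _

/-- `e^{-h/2} ≤ r*` (`Θ ≤ 1`, `h ≥ 0`). -/
theorem exp_neg_half_le_rstar {h : ℝ} (hh : 0 ≤ h) : Real.exp (-(h / 2)) ≤ rstar h := by
  rw [rstar, Real.exp_le_exp, neg_le_neg_iff]
  nlinarith [supRe_le_one]

/-- `r* / e^{-δ h} = R₁`. -/
theorem rstar_div_exp (h δ : ℝ) : rstar h / Real.exp (-(δ * h)) = outerR h δ := by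
  rw [rstar, outerR, ← Real.exp_sub]
  congr 1
  ring

/-- `‖w_ρ‖ = e^{-(Θ - 1/2 - |Re ρ - 1/2|) h}`. -/
theorem norm_wp (h : ℝ) (ρ : ZetaZeros.riemannZetaNontrivialZeros) :
    ‖wp h ρ‖ = Real.exp (-((supRe - 1 / 2 - |(ρ : ℂ).re - 1 / 2|) * h)) := by
  unfold wp
  rw [norm_div, Complex.norm_real, Real.norm_eq_abs, abs_of_pos (rstar_pos h), norm_pole, rstar,
    ← Real.exp_sub]
  congr 1
  ring

/-- `‖w_ρ‖ < 1` under non-attainment (`h > 0`). -/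
theorem norm_wp_lt_one {h : ℝ} (hh : 0 < h)
    (hlt : ∀ ρ : ℂ, ρ ∈ ZetaZeros.riemannZetaNontrivialZeros → ρ.re < supRe)
    (ρ : ZetaZeros.riemannZetaNontrivialZeros) : ‖wp h ρ‖ < 1 := by
  rw [norm_wp, Real.exp_lt_one_iff, neg_lt_zero]
  exact mul_pos (by linarith [abs_lt_of_forall_re_lt hlt ρ]) hh

/-- `e^{-δ h} < ‖w_ρ‖` for `ρ` in the top layer (`h > 0`). -/
theorem exp_neg_lt_norm_wp {h δ : ℝ} (hh : 0 < h) {ρ : ZetaZeros.riemannZetaNontrivialZeros}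
    (hρ : ρ ∈ topSet δ) : Real.exp (-(δ * h)) < ‖wp h ρ‖ := by
  have hlt : supRe - 1 / 2 - δ < |(ρ : ℂ).re - 1 / 2| := hρ
  rw [norm_wp, Real.exp_lt_exp, neg_lt_neg_iff]
  exact mul_lt_mul_of_pos_right (by linarith) hh

/-- **The Blaschke bound of one inverted pole**: for `ρ` in the top layer,
`1 - ‖w_ρ‖ ≤ h · (blTerm δ ρ + blTerm δ (1 - ρ̄))` — the depth of `ρ` (if `Re ρ > 1/2`) or of its
mirror image (if `Re ρ < 1/2`) below `Θ`. -/
theorem one_sub_norm_wp_le {h δ : ℝ} (hh : 0 ≤ h)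
    (hlt : ∀ ρ : ℂ, ρ ∈ ZetaZeros.riemannZetaNontrivialZeros → ρ.re < supRe)
    {ρ : ZetaZeros.riemannZetaNontrivialZeros} (hρ : ρ ∈ topSet δ) :
    1 - ‖wp h ρ‖ ≤ h * (blTerm δ ρ + blTerm δ (mirror ρ)) := by
  have htop : supRe - 1 / 2 - δ < |(ρ : ℂ).re - 1 / 2| := hρ
  set x : ℝ := supRe - 1 / 2 - |(ρ : ℂ).re - 1 / 2| with hx
  -- `1 - e^{-x h} ≤ x h`
  have h1 : 1 - ‖wp h ρ‖ ≤ x * h := by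
    rw [norm_wp]
    have := Real.add_one_le_exp (-(x * h))
    linarith
  -- `x ≤ blTerm δ ρ + blTerm δ (mirror ρ)`
  have hβ1 := hlt _ ρ.2
  have hβ2 := hlt _ (one_sub_conj_mem ρ.2)
  simp only [Complex.sub_re, Complex.one_re, Complex.conj_re] at hβ2
  have h2 : x ≤ blTerm δ ρ + blTerm δ (mirror ρ) := by
    have hn1 := blTerm_nonneg δ ρ
    have hn2 := blTerm_nonneg δ (mirror ρ)
    rcases le_or_gt (1 / 2 : ℝ) (ρ : ℂ).re with hge | hlt'
    · -- `Re ρ ≥ 1/2`: `x = Θ - Re ρ` is the `blTerm` of `ρ` itself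
      have habs : |(ρ : ℂ).re - 1 / 2| = (ρ : ℂ).re - 1 / 2 := abs_of_nonneg (by linarith)
      have hcond : supRe - δ < (ρ : ℂ).re ∧ (ρ : ℂ).re < supRe := ⟨by linarith, hβ1⟩
      have e : blTerm δ ρ = supRe - (ρ : ℂ).re := by
        unfold blTerm
        rw [if_pos hcond]
      rw [e, hx, habs]
      linarith
    · -- `Re ρ < 1/2`: `x = Θ - (1 - Re ρ)` is the `blTerm` of the mirror zero
      have habs : |(ρ : ℂ).re - 1 / 2| = -((ρ : ℂ).re - 1 / 2) := abs_of_neg (by linarith)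
      have hcond : supRe - δ < ((mirror ρ : ZetaZeros.riemannZetaNontrivialZeros) : ℂ).re ∧
          ((mirror ρ : ZetaZeros.riemannZetaNontrivialZeros) : ℂ).re < supRe := by
        rw [mirror_re]
        constructor <;> linarith
      have e : blTerm δ (mirror ρ) = supRe - (1 - (ρ : ℂ).re) := by
        unfold blTerm
        rw [if_pos hcond, mirror_re]
      rw [e, hx, habs]
      linarith
  calc 1 - ‖wp h ρ‖ ≤ x * h := h1
    _ = h * x := mul_comm _ _
    _ ≤ h * (blTerm δ ρ + blTerm δ (mirror ρ)) := by gcongr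

/-- **The inverted top layer is BLASCHKE under `BL(δ)`.** -/
theorem summable_one_sub_norm_wp {h δ : ℝ} (hh : 0 < h)
    (hlt : ∀ ρ : ℂ, ρ ∈ ZetaZeros.riemannZetaNontrivialZeros → ρ.re < supRe)
    (hBL : BlaschkeTop δ) : Summable fun ρ : topSet δ ↦ 1 - ‖wp h ρ‖ := by
  have hs : Summable (blTerm δ) := blaschkeTop_iff.1 hBL
  have hs2 : Summable fun ρ ↦ h * (blTerm δ ρ + blTerm δ (mirror ρ)) :=
    (hs.add (hs.comp_injective mirror_injective)).mul_left h
  refine Summable.of_nonneg_of_le (fun ρ ↦ ?_) (fun ρ ↦ one_sub_norm_wp_le hh.le hlt ρ.2)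
    (hs2.subtype _)
  linarith [norm_wp_lt_one hh hlt ρ]

end Summit.RiemannHypothesis.RiemannHypothesis.Theorems.Splittings.ScrewBlaschkeSeam
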